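import Literature.NumberTheory.LFunctions.FiniteEulerProductPhases
import HarnessLib

/-!
# Steering a block `∏_{N₁ ≤ p < M} (1 - b_p p^{-σ})⁻¹` of a finite Euler product

Topic `Literature/NumberTheory/LFunctions`. Everything in this file is PROVED (no named facts).

The tree's `Literature.NumberTheory.LFunctions.exists_phases_finiteEulerProduct_sub_lt`
(`FiniteEulerProductPhases.lean`; Bohr, Titchmarsh §11.9 step (i) for `ζ` instead of `log ζ`)
steers the FULL finite Euler product `∏_{p<M} (1 - p^{-σ} e^{2πiϑ_p})⁻¹` to any `w ≠ 0`. For the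
robust target of the `a`-point argument (Titchmarsh §11.10) the primes below a threshold `N₁`
must be kept free (two of them are used to hit the target value exactly, the others carry
prescribed phases), so we need the same statement for the BLOCK of primes in `[N₁, M)`:

* `Literature.NumberTheory.LFunctions.exists_unimodular_eulerBlock_sub_lt` — for `1/2 < σ ≤ 1`,
  `w ≠ 0`, `ε > 0` and thresholds `N₁`, `M₀` there are `M ≥ max N₁ M₀` and unimodular `b_p`
  with `|∏_{p prime, N₁ ≤ p < M} (1 - b_p p^{-σ})⁻¹ - w| < ε`.

The proof is the tree's proof verbatim with the head starting at `N₁` instead of `0`: a cut-off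
`N' ≥ max(N₁, M₀, 4)` with `Σ_{n ≥ N'} n^{-2σ}` and `N'^{-σ}` small, phases `1` on `[N₁, N')`,
the target `ℓ = log(w/F)` for the head `F`, the first `M` with `Σ_{N' ≤ p < M} p^{-σ} ≥ |ℓ|`
(divergence of `Σ p^{-σ}`, `σ ≤ 1`), and the common phase `e^{i arg ℓ}` on `[N', M)`.

## References

* [Titchmarsh1986] E. C. Titchmarsh, *The Theory of the Riemann Zeta-Function*, 2nd ed., §11.9
  (i) and §11.10.
-/

noncomputable section

open Complex Filter Topology Finset

namespace Literature.NumberTheory.LFunctions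

open FiniteEulerPhases EulerProductMeanSquare in
/-- **Steering a block of a finite Euler product to a prescribed non-zero value.** Let
`1/2 < σ ≤ 1`, `w ≠ 0`, `ε > 0`, `N₁ M₀ ∈ ℕ`. Then there are `M ≥ N₁`, `M ≥ M₀` and unimodular
coefficients `b_p` with `|∏_{p prime, N₁ ≤ p < M} (1 - b_p p^{-σ})⁻¹ - w| < ε`.
[cite: Titchmarsh1986, §11.9 (i) and §11.10] -/
theorem exists_unimodular_eulerBlock_sub_lt {σ : ℝ} (hσ : 1 / 2 < σ) (hσ1 : σ ≤ 1) {w : ℂ}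
    (hw : w ≠ 0) {ε : ℝ} (hε : 0 < ε) (N₁ M₀ : ℕ) :
    ∃ M : ℕ, N₁ ≤ M ∧ M₀ ≤ M ∧ ∃ b : ℕ → ℂ, (∀ p, ‖b p‖ = 1) ∧
      ‖∏ p ∈ (Finset.Ico N₁ M).filter Nat.Prime, (1 - b p * (p : ℂ) ^ (-(σ : ℂ)))⁻¹ - w‖ < ε := by
  have hσ0 : 0 < σ := by linarith
  have hw0 : 0 < ‖w‖ := norm_pos_iff.2 hw
  -- the tolerance `η`
  set η : ℝ := min (1 / 4) (ε / (8 * ‖w‖)) with hη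
  have hη0 : 0 < η := lt_min (by norm_num) (by positivity)
  have hη4 : η ≤ 1 / 4 := min_le_left _ _
  have hηε : 8 * ‖w‖ * η ≤ ε := by
    have := min_le_right (1 / 4) (ε / (8 * ‖w‖))
    rw [← hη] at this
    rwa [le_div_iff₀ (by positivity), mul_comm] at this
  -- the cut-off `N'`: beyond `N₁`, `M₀` and `4`, with small tail `Σ_{n≥N'} n^{-2σ}` and `N'^{-σ} < η`
  have e1 : ∀ᶠ N : ℕ in atTop, ∑' k : ℕ, ((k + N : ℕ) : ℝ) ^ (-(2 * σ)) < η :=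
    (tendsto_tsum_rpow_tail (σ := σ)).eventually_lt_const hη0
  have e2 : ∀ᶠ N : ℕ in atTop, (N : ℝ) ^ (-σ) < η :=
    ((tendsto_rpow_neg_atTop hσ0).comp tendsto_natCast_atTop_atTop).eventually_lt_const hη0
  obtain ⟨N', hN'⟩ := eventually_atTop.1
    (e1.and (e2.and (eventually_ge_atTop (max (max M₀ 4) N₁))))
  obtain ⟨htail, hN'σ, hN'max⟩ := hN' N' le_rfl
  have hN'M₀ : M₀ ≤ N' := ((le_max_left _ _).trans (le_max_left _ _)).trans hN'max
  have hN'4 : 4 ≤ N' := ((le_max_right _ _).trans (le_max_left _ _)).trans hN'max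
  have hN'N₁ : N₁ ≤ N' := (le_max_right _ _).trans hN'max
  -- norms of the local data `p^{-σ}`
  have hnorm : ∀ p : ℕ, 0 < p → ‖(p : ℂ) ^ (-(σ : ℂ))‖ = (p : ℝ) ^ (-σ) := fun p hp ↦ by
    rw [Complex.norm_natCast_cpow_of_pos hp]; simp
  have hfac : ∀ p : ℕ, p.Prime → (p : ℝ) ^ (-σ) < 1 := fun p hp ↦
    Real.rpow_lt_one_of_one_lt_of_neg (by exact_mod_cast hp.one_lt) (by linarith)
  -- the head `F = ∏_{N₁ ≤ p < N'} (1 - p^{-σ})⁻¹ ≠ 0` and the target `ℓ = log (w/F)`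
  set F : ℂ := ∏ p ∈ (Finset.Ico N₁ N').filter Nat.Prime, (1 - (p : ℂ) ^ (-(σ : ℂ)))⁻¹ with hF
  have hF0 : F ≠ 0 := by
    rw [hF]
    refine Finset.prod_ne_zero_iff.2 fun p hp ↦ inv_ne_zero (sub_ne_zero.2 fun h ↦ ?_)
    have hp' : p.Prime := (Finset.mem_filter.1 hp).2
    have h1 := hfac p hp'
    have h2 : ‖(p : ℂ) ^ (-(σ : ℂ))‖ = 1 := by rw [← h, norm_one]
    rw [hnorm p hp'.pos] at h2
    linarith
  set ℓ : ℂ := Complex.log (w / F) with hℓ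
  -- the prime sums and the choice of `M`
  set S : ℕ → ℝ := fun m ↦ ∑ p ∈ (Finset.Ico N' m).filter Nat.Prime, (p : ℝ) ^ (-σ) with hS
  have hex : ∃ m : ℕ, N' ≤ m ∧ ‖ℓ‖ ≤ S m := exists_prime_sum_ge hσ1 N' ‖ℓ‖
  classical
  set M : ℕ := Nat.find hex with hM
  obtain ⟨hN'M, hℓM⟩ : N' ≤ M ∧ ‖ℓ‖ ≤ S M := Nat.find_spec hex
  have hSM : S M < ‖ℓ‖ + η := by
    rcases Nat.eq_or_lt_of_le hN'M with h | h
    · have : S M = 0 := by rw [hS, ← h]; simp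
      rw [this]; linarith [norm_nonneg ℓ]
    · obtain ⟨m, hMm⟩ : ∃ m, M = m + 1 := ⟨M - 1, by omega⟩
      have hm : N' ≤ m := by omega
      have hmin : ¬ (N' ≤ m ∧ ‖ℓ‖ ≤ S m) :=
        Nat.find_min hex (show m < Nat.find hex by rw [← hM]; omega)
      have hlt : S m < ‖ℓ‖ := by
        by_contra hge; exact hmin ⟨hm, le_of_not_gt hge⟩
      have hstep : S (m + 1) ≤ S m + (m : ℝ) ^ (-σ) := prime_sum_succ_le hm
      have hmσ : (m : ℝ) ^ (-σ) ≤ (N' : ℝ) ^ (-σ) :=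
        Real.rpow_le_rpow_of_nonpos (by exact_mod_cast (show 0 < N' by omega))
          (by exact_mod_cast hm) (by linarith)
      rw [hMm]
      linarith
  -- the phases: `1` below `N'`, the common phase `e^{i arg ℓ}` above
  set u : ℂ := cexp (((Complex.arg ℓ : ℝ) : ℂ) * I) with hu
  have hunit : ‖u‖ = 1 := by rw [hu, Complex.norm_exp_ofReal_mul_I]
  set b : ℕ → ℂ := fun p ↦ if p < N' then 1 else u with hb
  have hbn : ∀ p, ‖b p‖ = 1 := fun p ↦ by
    simp only [hb]; split_ifs <;> simp [hunit]
  refine ⟨M, hN'N₁.trans hN'M, hN'M₀.trans hN'M, b, hbn, ?_⟩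
  -- split the product at `N'`
  set z : ℕ → ℂ := fun p ↦ b p * (p : ℂ) ^ (-(σ : ℂ)) with hz
  set A : Finset ℕ := (Finset.Ico N' M).filter Nat.Prime with hA
  have hsplit : (Finset.Ico N₁ M).filter Nat.Prime = (Finset.Ico N₁ N').filter Nat.Prime ∪ A := by
    rw [hA, ← Finset.filter_union, Finset.Ico_union_Ico_eq_Ico hN'N₁ hN'M]
  have hdisj : Disjoint ((Finset.Ico N₁ N').filter Nat.Prime) A := by
    rw [hA]
    exact Finset.disjoint_filter_filter (Finset.Ico_disjoint_Ico_consecutive N₁ N' M)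
  have hhead : ∏ p ∈ (Finset.Ico N₁ N').filter Nat.Prime, (1 - z p)⁻¹ = F := by
    rw [hF]
    refine Finset.prod_congr rfl fun p hp ↦ ?_
    have hpN : p < N' := (Finset.mem_Ico.1 (Finset.mem_filter.1 hp).1).2
    simp only [hz, hb, if_pos hpN, one_mul]
  -- on `A` the local data are `z_p = u p^{-σ}`, of norm `p^{-σ} ≤ 1/2`
  have hzA : ∀ p ∈ A, z p = u * (p : ℂ) ^ (-(σ : ℂ)) := by
    intro p hp
    rw [hA, Finset.mem_filter, Finset.mem_Ico] at hp
    simp only [hz, hb, if_neg (not_lt.2 hp.1.1)]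
  have hznorm : ∀ p ∈ A, ‖z p‖ = (p : ℝ) ^ (-σ) := by
    intro p hp
    have hp' : p.Prime := by rw [hA] at hp; exact (Finset.mem_filter.1 hp).2
    rw [hzA p hp, norm_mul, hunit, one_mul, hnorm p hp'.pos]
  have hzhalf : ∀ p ∈ A, ‖z p‖ ≤ 1 / 2 := by
    intro p hp
    rw [hznorm p hp]
    have hp' : N' ≤ p := by
      rw [hA, Finset.mem_filter, Finset.mem_Ico] at hp; exact hp.1.1
    have h4p : (4 : ℝ) ≤ p := by exact_mod_cast hN'4.trans hp'
    calc (p : ℝ) ^ (-σ) ≤ (4 : ℝ) ^ (-σ) := Real.rpow_le_rpow_of_nonpos (by norm_num) h4p (by linarith)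
      _ ≤ (4 : ℝ) ^ (-(1 / 2) : ℝ) := Real.rpow_le_rpow_of_exponent_le (by norm_num) (by linarith)
      _ = 1 / 2 := by
          rw [show (4 : ℝ) = 2 ^ (2 : ℝ) by norm_num, ← Real.rpow_mul (by norm_num)]
          norm_num
  -- the sum of the `z_p` over `A` is `S(M) e^{i arg ℓ}`, within `η` of `ℓ`
  have hsumz : ∑ p ∈ A, z p = ((S M : ℝ) : ℂ) * u := by
    rw [Finset.sum_congr rfl hzA, ← Finset.mul_sum, mul_comm]
    congr 1
    rw [hS]
    push_cast
    refine Finset.sum_congr rfl fun p hp ↦ ?_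
    have hp' : p.Prime := (Finset.mem_filter.1 hp).2
    rw [show (p : ℂ) = ((p : ℝ) : ℂ) by simp, Complex.ofReal_cpow (Nat.cast_nonneg p)]
    simp
  have hℓu : (‖ℓ‖ : ℂ) * u = ℓ := by rw [hu]; exact Complex.norm_mul_exp_arg_mul_I ℓ
  have hsumz_ℓ : ‖∑ p ∈ A, z p - ℓ‖ < η := by
    have key : ∑ p ∈ A, z p - ℓ = ((S M - ‖ℓ‖ : ℝ) : ℂ) * u := by
      rw [hsumz]
      nth_rewrite 1 [← hℓu]
      push_cast
      ring
    rw [key, norm_mul, hunit, mul_one, Complex.norm_real, Real.norm_eq_abs, abs_lt]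
    constructor <;> linarith
  -- the second-order terms
  have hsq : ∑ p ∈ A, ‖z p‖ ^ 2 < η := by
    have h1 : ∑ p ∈ A, ‖z p‖ ^ 2 = ∑ p ∈ A, (p : ℝ) ^ (-(2 * σ)) := by
      refine Finset.sum_congr rfl fun p hp ↦ ?_
      rw [hznorm p hp, ← Real.rpow_natCast, ← Real.rpow_mul (Nat.cast_nonneg p)]
      congr 1; push_cast; ring
    have h2 : ∑ p ∈ A, (p : ℝ) ^ (-(2 * σ)) ≤ ∑ n ∈ Finset.Ico N' M, (n : ℝ) ^ (-(2 * σ)) :=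
      Finset.sum_le_sum_of_subset_of_nonneg (Finset.filter_subset _ _) fun _ _ _ ↦ by positivity
    have h3 := sum_Ico_rpow_le_tsum hσ N' M
    linarith
  -- assemble
  have hlog := norm_sum_log_sub_sum_le A hzhalf
  set δ : ℂ := ∑ p ∈ A, Complex.log (1 - z p)⁻¹ - ℓ with hδ
  have hδn : ‖δ‖ ≤ 2 * η := by
    have : δ = (∑ p ∈ A, Complex.log (1 - z p)⁻¹ - ∑ p ∈ A, z p) + (∑ p ∈ A, z p - ℓ) := by
      rw [hδ]; ring
    rw [this]
    refine (norm_add_le _ _).trans ?_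
    linarith
  have hprodA : ∏ p ∈ A, (1 - z p)⁻¹ = (w / F) * cexp δ := by
    rw [prod_inv_one_sub_eq_exp_sum_log A fun p hp ↦ (hzhalf p hp).trans_lt (by norm_num)]
    have : ∑ p ∈ A, Complex.log (1 - z p)⁻¹ = ℓ + δ := by rw [hδ]; ring
    rw [this, Complex.exp_add, hℓ, Complex.exp_log (div_ne_zero hw hF0)]
  have hprod : ∏ p ∈ (Finset.Ico N₁ M).filter Nat.Prime, (1 - z p)⁻¹ = w * cexp δ := by
    rw [hsplit, Finset.prod_union hdisj, hhead, hprodA]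
    field_simp
  change ‖∏ p ∈ (Finset.Ico N₁ M).filter Nat.Prime, (1 - z p)⁻¹ - w‖ < ε
  rw [hprod, ← mul_sub_one, norm_mul]
  have hexp : ‖cexp δ - 1‖ ≤ 2 * ‖δ‖ := Complex.norm_exp_sub_one_le (by linarith)
  calc ‖w‖ * ‖cexp δ - 1‖ ≤ ‖w‖ * (2 * (2 * η)) := by
        refine mul_le_mul_of_nonneg_left (hexp.trans (by linarith)) hw0.le
    _ < ε := by nlinarith
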